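import Literature.MathematicalPhysics.StatisticalMechanics.HcpFccLatticeSumsTail

/-!
# Certified hcp/fcc lattice sums: the `ℤ³` sums organised by layers

* `hcpTerm_eq_layerTerm`: `hcpTerm n c (k,i,j) = layerTerm [k odd] n (k²c²) (i,j)`;
  `fccTerm_eq_layerTerm`: `fccTerm n c (k, ij) = layerTerm [3 ∤ k] n (k²c²) (fccLayerEquiv k ij)`
  (fcc layer `k` is the pattern layer `[3 ∤ k]` translated by `(⌊k/3⌋, ⌊k/3⌋)`, reflected when
  `k ≡ 2 (3)`: `fccForm (3q, i, j) = Q₀(i+q, j+q)`, `fccForm (3q+1,·) = Q₁(i+q, j+q)`,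
  `fccForm (3q+2,·) = Q₁(−(i+q+1), −(j+q+1))`);
* summability over `ℤ³` for `n ≥ 2`, `c ≠ 0` (`summable_prod_of_nonneg`: each layer is summable and
  `k ↦ layerSum` has the summable majorant `((c²)⁻¹ + 24)(c²)^{-d} k^{-2d}`), and the layer
  decompositions `hcpInvPowSum n c = ∑'_k layerSum [k odd] n (k²c²)`,
  `fccInvPowSum n c = ∑'_k layerSum [3 ∤ k] n (k²c²)`;
* **the stacking difference** `hcpInvPowSum n c − fccInvPowSum n c = ∑'_k ([3 ∤ k] − [2 ∤ k]) J⁽ⁿ⁾(k²c²)`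
  (`hcp_sub_fcc_eq_tsum`): whole layers cancel unless `k ≡ 2, 3, 4 (mod 6)`;
* truncation of even sums over `ℤ` (`tsum_int_even_trunc`, `tsum_int_even_trunc_nonneg`) and the
  telescoping bound `∑_{k>K} k^{-(d+1)} ≤ 1/(d K^d)` (`sum_inv_pow_Ioc_le`).  [folklore]
-/

noncomputable section

namespace Literature.MathematicalPhysics.StatisticalMechanics.StackingSums

open Finset

/-! ## hcp: the `ℤ³` family is the layer family -/

/-- **hcp terms are layer terms**: `hcpTerm n c (k,i,j) = layerTerm [k odd] n (k²c²) (i,j)` for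
`n ≠ 0` (at the omitted site both sides vanish, the right one by `0⁻¹ = 0`). [folklore] -/
theorem hcpTerm_eq_layerTerm {n : ℕ} (hn : n ≠ 0) (c : ℝ) (k i j : ℤ) :
    hcpTerm n c (k, i, j) = layerTerm (if Even k then 0 else 1) n ((k : ℝ) ^ 2 * c ^ 2) (i, j) := by
  unfold hcpTerm layerTerm
  by_cases h0 : ((k, i, j) : ℤ × ℤ × ℤ) = 0
  · rw [if_pos h0]
    simp only [Prod.mk_eq_zero] at h0
    obtain ⟨rfl, rfl, rfl⟩ := h0
    simp [stackForm, hn]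
  · rw [if_neg h0, hcpForm_eq_stackForm]

/-- The pattern index is at most `1`. [folklore] -/
theorem pattern_le_one (P : Prop) [Decidable P] : (if P then 0 else 1 : ℕ) ≤ 1 := by
  split_ifs <;> norm_num

/-- The hcp layer families are summable (`n ≥ 2`). [folklore] -/
theorem hcpTerm_layer_summable {n : ℕ} (hn : 2 ≤ n) (c : ℝ) (k : ℤ) :
    Summable fun ij : ℤ × ℤ => hcpTerm n c (k, ij) := by
  have h := layerTerm_summable (δ := if Even k then 0 else 1) (pattern_le_one _)
    (s := (k : ℝ) ^ 2 * c ^ 2) (by positivity) hn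
  refine h.congr fun ij => ?_
  obtain ⟨i, j⟩ := ij
  exact (hcpTerm_eq_layerTerm (by omega) c k i j).symm

/-- **hcp layer sums**: `∑'_{(i,j)} hcpTerm n c (k,i,j) = layerSum [k odd] n (k²c²)`. [folklore] -/
theorem tsum_hcpTerm_layer {n : ℕ} (hn : n ≠ 0) (c : ℝ) (k : ℤ) :
    ∑' ij : ℤ × ℤ, hcpTerm n c (k, ij) = layerSum (if Even k then 0 else 1) n ((k : ℝ) ^ 2 * c ^ 2) := by
  unfold layerSum
  refine tsum_congr fun ij => ?_
  obtain ⟨i, j⟩ := ij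
  exact hcpTerm_eq_layerTerm hn c k i j

/-! ## fcc: each layer is a translated (or reflected) pattern layer -/

/-- `k ≡ 0 (3)`: `fccForm (3q, i, j) = Q₀(i+q, j+q)`. [folklore] -/
theorem fccForm_three_mul (q i j : ℤ) : fccForm (3 * q, i, j) = stackForm 0 (i + q) (j + q) := by
  simp only [fccForm, stackForm_zero, Int.cast_add, Int.cast_mul, Int.cast_ofNat]
  ring

/-- `k ≡ 1 (3)`: `fccForm (3q+1, i, j) = Q₁(i+q, j+q)`. [folklore] -/
theorem fccForm_three_mul_add_one (q i j : ℤ) :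
    fccForm (3 * q + 1, i, j) = stackForm 1 (i + q) (j + q) := by
  simp only [fccForm, stackForm_one, Int.cast_add, Int.cast_mul, Int.cast_ofNat, Int.cast_one]
  ring

/-- `k ≡ 2 (3)`: `fccForm (3q+2, i, j) = Q₁(−(i+q+1), −(j+q+1))`. [folklore] -/
theorem fccForm_three_mul_add_two (q i j : ℤ) :
    fccForm (3 * q + 2, i, j) = stackForm 1 (-(i + q + 1)) (-(j + q + 1)) := by
  simp only [fccForm, stackForm_one, Int.cast_add, Int.cast_mul, Int.cast_ofNat, Int.cast_one,
    Int.cast_neg]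
  ring

/-- **fcc terms are reindexed layer terms**: `fccTerm n c (k, ij) = layerTerm [3 ∤ k] n (k²c²) (e ij)`
with `e = fccLayerEquiv k` (`n ≠ 0`). [folklore] -/
theorem fccTerm_eq_layerTerm {n : ℕ} (hn : n ≠ 0) (c : ℝ) (k : ℤ) (ij : ℤ × ℤ) :
    fccTerm n c (k, ij) =
      layerTerm (if k % 3 = 0 then 0 else 1) n ((k : ℝ) ^ 2 * c ^ 2) (fccLayerEquiv k ij) := by
  obtain ⟨i, j⟩ := ij
  -- the squared norm in pattern form
  have hform : fccForm (k, i, j) = stackForm (if k % 3 = 0 then 0 else 1)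
      (fccLayerEquiv k (i, j)).1 (fccLayerEquiv k (i, j)).2 := by
    have hcases : k % 3 = 0 ∨ k % 3 = 1 ∨ k % 3 = 2 := by omega
    rcases hcases with h | h | h
    · have he : fccLayerEquiv k (i, j) = (i + k / 3, j + k / 3) := by
        simp [fccLayerEquiv, h]
      rw [if_pos h, he, ← fccForm_three_mul]
      congr 2; omega
    · have he : fccLayerEquiv k (i, j) = (i + k / 3, j + k / 3) := by
        simp [fccLayerEquiv, h]
      rw [if_neg (by omega), he, ← fccForm_three_mul_add_one]
      congr 2; omega
    · have he : fccLayerEquiv k (i, j) = (-(i + (k / 3 + 1)), -(j + (k / 3 + 1))) := by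
        simp [fccLayerEquiv, h]
      rw [if_neg (by omega), he]
      have e := fccForm_three_mul_add_two (k / 3) i j
      rw [show i + k / 3 + 1 = i + (k / 3 + 1) by ring, show j + k / 3 + 1 = j + (k / 3 + 1) by ring] at e
      rw [← e]
      congr 2; omega
  unfold fccTerm layerTerm
  by_cases h0 : ((k, (i, j)) : ℤ × ℤ × ℤ) = 0
  · -- the omitted site: k = 0, (i,j) = 0, pattern 0, e = id
    rw [if_pos h0]
    simp only [Prod.mk_eq_zero] at h0
    obtain ⟨rfl, rfl, rfl⟩ := h0
    simp [fccLayerEquiv, stackForm, hn]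
  · rw [if_neg h0, hform]

/-- The fcc layer families are summable (`n ≥ 2`). [folklore] -/
theorem fccTerm_layer_summable {n : ℕ} (hn : 2 ≤ n) (c : ℝ) (k : ℤ) :
    Summable fun ij : ℤ × ℤ => fccTerm n c (k, ij) := by
  have h := layerTerm_summable (δ := if k % 3 = 0 then 0 else 1) (pattern_le_one _)
    (s := (k : ℝ) ^ 2 * c ^ 2) (by positivity) hn
  have h' := (fccLayerEquiv k).summable_iff.mpr h
  refine h'.congr fun ij => ?_
  exact (fccTerm_eq_layerTerm (by omega) c k ij).symm

/-- **fcc layer sums**: `∑'_{(i,j)} fccTerm n c (k,i,j) = layerSum [3 ∤ k] n (k²c²)`. [folklore] -/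
theorem tsum_fccTerm_layer {n : ℕ} (hn : n ≠ 0) (c : ℝ) (k : ℤ) :
    ∑' ij : ℤ × ℤ, fccTerm n c (k, ij) = layerSum (if k % 3 = 0 then 0 else 1) n ((k : ℝ) ^ 2 * c ^ 2) := by
  unfold layerSum
  rw [← (fccLayerEquiv k).tsum_eq (layerTerm (if k % 3 = 0 then 0 else 1) n ((k : ℝ) ^ 2 * c ^ 2))]
  exact tsum_congr fun ij => fccTerm_eq_layerTerm hn c k ij

/-! ## Summability over `ℤ³` through the layers -/

/-- **A summable majorant for the layer sums**: for `δ ≤ 1`, `n = d + 1` with `d ≥ 1`, `c ≠ 0` and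
`k ≠ 0`, `layerSum δ n (k²c²) ≤ ((c²)⁻¹ + 24) ((c²)⁻¹)^d · (1 / k^{2d})`. [folklore] -/
theorem layerSum_le_majorant {δ : ℕ} (hδ : δ ≤ 1) {d : ℕ} (hd : 1 ≤ d) {c : ℝ} (hc : c ≠ 0) {k : ℤ}
    (hk : k ≠ 0) :
    layerSum δ (d + 1) ((k : ℝ) ^ 2 * c ^ 2) ≤
      ((c ^ 2)⁻¹ + 24) * ((c ^ 2)⁻¹) ^ d * (1 / (k : ℝ) ^ (2 * d)) := by
  have hc2 : 0 < c ^ 2 := by positivity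
  have hk1 : (1 : ℝ) ≤ (k : ℝ) ^ 2 := by
    have : (1 : ℤ) ≤ k ^ 2 := by nlinarith [sq_nonneg k, Int.one_le_abs hk, sq_abs k]
    exact_mod_cast this
  have hs : 0 < (k : ℝ) ^ 2 * c ^ 2 := by positivity
  have h := layerSum_le_of_pos hδ hs hd
  set s := (k : ℝ) ^ 2 * c ^ 2 with hsdef
  have hα : 8 / ((if δ = 0 then 3 / 4 else 1 / 3 : ℝ) * d) ≤ 24 := by
    have hd' : (1 : ℝ) ≤ d := by exact_mod_cast hd
    rw [div_le_iff₀ (by split_ifs <;> positivity)]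
    split_ifs <;> nlinarith
  have hsd : 0 ≤ (s⁻¹) ^ d := by positivity
  have h1 : layerSum δ (d + 1) s ≤ (s⁻¹ + 24) * (s⁻¹) ^ d := by
    calc layerSum δ (d + 1) s ≤ (s⁻¹) ^ (d + 1) + 8 / ((if δ = 0 then 3 / 4 else 1 / 3 : ℝ) * d) * (s⁻¹) ^ d := h
      _ ≤ (s⁻¹) ^ (d + 1) + 24 * (s⁻¹) ^ d := by nlinarith
      _ = (s⁻¹ + 24) * (s⁻¹) ^ d := by ring
  -- compare `s⁻¹ ≤ (c²)⁻¹` and `(s⁻¹)^d = ((c²)⁻¹)^d / k^{2d}`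
  have hsc : s⁻¹ ≤ (c ^ 2)⁻¹ := by
    apply inv_anti₀ hc2
    rw [hsdef]; nlinarith
  have hsd_eq : (s⁻¹) ^ d = ((c ^ 2)⁻¹) ^ d * (1 / (k : ℝ) ^ (2 * d)) := by
    rw [hsdef, mul_inv, mul_pow, pow_mul, one_div, inv_pow]; ring
  calc layerSum δ (d + 1) s ≤ (s⁻¹ + 24) * (s⁻¹) ^ d := h1
    _ ≤ ((c ^ 2)⁻¹ + 24) * (s⁻¹) ^ d := by nlinarith
    _ = ((c ^ 2)⁻¹ + 24) * ((c ^ 2)⁻¹) ^ d * (1 / (k : ℝ) ^ (2 * d)) := by rw [hsd_eq]; ring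

/-- **Summability over the layers**: for any pattern assignment `p : ℤ → ℕ` with `p k ≤ 1`,
`n ≥ 2` and `c ≠ 0`, `k ↦ layerSum (p k) n (k²c²)` is summable over `ℤ`. [folklore] -/
theorem summable_layerSum {p : ℤ → ℕ} (hp : ∀ k, p k ≤ 1) {n : ℕ} (hn : 2 ≤ n) {c : ℝ} (hc : c ≠ 0) :
    Summable fun k : ℤ => layerSum (p k) n ((k : ℝ) ^ 2 * c ^ 2) := by
  obtain ⟨d, rfl⟩ : ∃ d, n = d + 1 := ⟨n - 1, by omega⟩
  have hd : 1 ≤ d := by omega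
  set B : ℝ := ((c ^ 2)⁻¹ + 24) * ((c ^ 2)⁻¹) ^ d with hB
  set M : ℤ → ℝ := fun k => B * (1 / (k : ℝ) ^ (2 * d)) +
    (if k = 0 then layerSum (p 0) (d + 1) 0 else 0) with hM
  have hMsum : Summable M := by
    apply Summable.add
    · exact ((Real.summable_one_div_int_pow (p := 2 * d)).mpr (by omega)).mul_left B
    · exact (hasSum_ite_eq (0 : ℤ) (layerSum (p 0) (d + 1) 0)).summable
  refine Summable.of_nonneg_of_le (fun k => layerSum_nonneg (hp k) _ (by positivity)) (fun k => ?_) hMsum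
  by_cases hk : k = 0
  · subst hk
    simp only [hM, if_true, Int.cast_zero]
    have : 0 ≤ B * (1 / (0 : ℝ) ^ (2 * d)) := by
      rw [zero_pow (by omega)]; simp
    simpa using this
  · simp only [hM, if_neg hk, add_zero]
    exact layerSum_le_majorant (hp k) hd hc hk

/-- **hcp: summability over `ℤ³`** (`n ≥ 2`, `c ≠ 0`). [folklore] -/
theorem hcpTerm_summable {n : ℕ} (hn : 2 ≤ n) {c : ℝ} (hc : c ≠ 0) : Summable (hcpTerm n c) := by
  have hnn : 0 ≤ hcpTerm n c := by
    intro v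
    obtain ⟨k, i, j⟩ := v
    rw [hcpTerm_eq_layerTerm (by omega)]
    exact layerTerm_nonneg (pattern_le_one _) _ (by positivity) _
  refine (summable_prod_of_nonneg hnn).mpr ⟨fun k => hcpTerm_layer_summable hn c k, ?_⟩
  have h := summable_layerSum (p := fun k : ℤ => if Even k then 0 else 1) (fun k => pattern_le_one _) hn hc
  refine h.congr fun k => ?_
  exact (tsum_hcpTerm_layer (by omega) c k).symm

/-- **fcc: summability over `ℤ³`** (`n ≥ 2`, `c ≠ 0`). [folklore] -/
theorem fccTerm_summable {n : ℕ} (hn : 2 ≤ n) {c : ℝ} (hc : c ≠ 0) : Summable (fccTerm n c) := by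
  have hnn : 0 ≤ fccTerm n c := by
    intro v
    obtain ⟨k, ij⟩ := v
    rw [fccTerm_eq_layerTerm (by omega)]
    exact layerTerm_nonneg (pattern_le_one _) _ (by positivity) _
  refine (summable_prod_of_nonneg hnn).mpr ⟨fun k => fccTerm_layer_summable hn c k, ?_⟩
  have h := summable_layerSum (p := fun k : ℤ => if k % 3 = 0 then 0 else 1) (fun k => pattern_le_one _) hn hc
  refine h.congr fun k => ?_
  exact (tsum_fccTerm_layer (by omega) c k).symm

/-- **hcp lattice sum by layers**: `hcpInvPowSum n c = ∑'_k layerSum [k odd] n (k²c²)`. [folklore] -/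
theorem hcpInvPowSum_eq_tsum_layerSum {n : ℕ} (hn : 2 ≤ n) {c : ℝ} (hc : c ≠ 0) :
    hcpInvPowSum n c = ∑' k : ℤ, layerSum (if Even k then 0 else 1) n ((k : ℝ) ^ 2 * c ^ 2) := by
  unfold hcpInvPowSum
  rw [(hcpTerm_summable hn hc).tsum_prod' (fun k => hcpTerm_layer_summable hn c k)]
  exact tsum_congr fun k => tsum_hcpTerm_layer (by omega) c k

/-- **fcc lattice sum by layers**: `fccInvPowSum n c = ∑'_k layerSum [3 ∤ k] n (k²c²)`. [folklore] -/
theorem fccInvPowSum_eq_tsum_layerSum {n : ℕ} (hn : 2 ≤ n) {c : ℝ} (hc : c ≠ 0) :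
    fccInvPowSum n c = ∑' k : ℤ, layerSum (if k % 3 = 0 then 0 else 1) n ((k : ℝ) ^ 2 * c ^ 2) := by
  unfold fccInvPowSum
  rw [(fccTerm_summable hn hc).tsum_prod' (fun k => fccTerm_layer_summable hn c k)]
  exact tsum_congr fun k => tsum_fccTerm_layer (by omega) c k

/-! ## The difference is a signed sum of registry couplings -/

/-- Layer by layer, `layerSum [k odd] − layerSum [3 ∤ k] = ([3 ∤ k] − [k odd]) · J(k²c²)`
(whole layers cancel unless exactly one of the two stackings is aligned at distance `k`).
[folklore] -/
theorem layerSum_hcp_sub_fcc (n : ℕ) (c : ℝ) (k : ℤ) :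
    layerSum (if Even k then 0 else 1) n ((k : ℝ) ^ 2 * c ^ 2) -
      layerSum (if k % 3 = 0 then 0 else 1) n ((k : ℝ) ^ 2 * c ^ 2) =
      ((if k % 3 = 0 then (0 : ℝ) else 1) - (if k % 2 = 0 then (0 : ℝ) else 1)) *
        registryCoupling n ((k : ℝ) ^ 2 * c ^ 2) := by
  have he : Even k ↔ k % 2 = 0 := Int.even_iff
  unfold registryCoupling
  by_cases h2 : k % 2 = 0 <;> by_cases h3 : k % 3 = 0 <;>
    simp only [he, h2, h3, if_true, if_false] <;> ring

/-- **The stacking difference**: for `n ≥ 2`, `c ≠ 0`,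
`hcpInvPowSum n c − fccInvPowSum n c = ∑'_k ([3 ∤ k] − [2 ∤ k]) J⁽ⁿ⁾(k²c²)`, and this family is
summable. [folklore] -/
theorem hcp_sub_fcc_eq_tsum {n : ℕ} (hn : 2 ≤ n) {c : ℝ} (hc : c ≠ 0) :
    Summable (fun k : ℤ => ((if k % 3 = 0 then (0 : ℝ) else 1) - (if k % 2 = 0 then (0 : ℝ) else 1)) *
        registryCoupling n ((k : ℝ) ^ 2 * c ^ 2)) ∧
    hcpInvPowSum n c - fccInvPowSum n c =
      ∑' k : ℤ, ((if k % 3 = 0 then (0 : ℝ) else 1) - (if k % 2 = 0 then (0 : ℝ) else 1)) *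
        registryCoupling n ((k : ℝ) ^ 2 * c ^ 2) := by
  have hh := summable_layerSum (p := fun k : ℤ => if Even k then 0 else 1) (fun k => pattern_le_one _) hn hc
  have hf := summable_layerSum (p := fun k : ℤ => if k % 3 = 0 then 0 else 1) (fun k => pattern_le_one _) hn hc
  have hdiff := hh.sub hf
  have hcongr : (fun k : ℤ => layerSum (if Even k then 0 else 1) n ((k : ℝ) ^ 2 * c ^ 2) -
      layerSum (if k % 3 = 0 then 0 else 1) n ((k : ℝ) ^ 2 * c ^ 2)) =
      fun k : ℤ => ((if k % 3 = 0 then (0 : ℝ) else 1) - (if k % 2 = 0 then (0 : ℝ) else 1)) *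
        registryCoupling n ((k : ℝ) ^ 2 * c ^ 2) := funext fun k => layerSum_hcp_sub_fcc n c k
  rw [hcongr] at hdiff
  refine ⟨hdiff, ?_⟩
  rw [hcpInvPowSum_eq_tsum_layerSum hn hc, fccInvPowSum_eq_tsum_layerSum hn hc, ← hh.tsum_sub hf]
  exact tsum_congr fun k => layerSum_hcp_sub_fcc n c k

/-! ## Truncating even sums over `ℤ` -/

/-- Telescoping `∑_{k=K+1}^{K+N} k^{-(d+1)} ≤ (1/d)(K^{-d})` (`K ≥ 1`, `d ≥ 1`). [folklore] -/
theorem sum_inv_pow_Ioc_le {d : ℕ} (hd : 1 ≤ d) {K : ℕ} (hK : 1 ≤ K) (N : ℕ) :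
    ∑ m ∈ range N, (((m + K + 1 : ℕ) : ℝ)⁻¹) ^ (d + 1) ≤ 1 / d * ((K : ℝ)⁻¹) ^ d := by
  have hd' : (0 : ℝ) < d := by exact_mod_cast hd
  have key : ∀ N, ∑ m ∈ range N, (((m + K + 1 : ℕ) : ℝ)⁻¹) ^ (d + 1) ≤
      1 / d * (((K : ℝ)⁻¹) ^ d - (((N + K : ℕ) : ℝ)⁻¹) ^ d) := by
    intro N
    induction N with
    | zero => simp
    | succ N ih =>
      rw [sum_range_succ]
      have hA : (0 : ℝ) < ((N + K : ℕ) : ℝ) := by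
        have : 1 ≤ N + K := by omega
        exact_mod_cast this
      have hAB : ((N + K : ℕ) : ℝ) ≤ ((N + K + 1 : ℕ) : ℝ) := by push_cast; linarith
      have h := inv_pow_sub_inv_pow_ge hA hAB d
      rw [show ((N + K + 1 : ℕ) : ℝ) - ((N + K : ℕ) : ℝ) = 1 by push_cast; ring, mul_one] at h
      rw [show ((N + 1 + K : ℕ) : ℝ) = ((N + K + 1 : ℕ) : ℝ) by push_cast; ring]
      have e : (((N + K + 1 : ℕ) : ℝ)⁻¹) ^ (d + 1) ≤
          1 / d * ((((N + K : ℕ) : ℝ)⁻¹) ^ d - (((N + K + 1 : ℕ) : ℝ)⁻¹) ^ d) := by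
        rw [div_mul_eq_mul_div, le_div_iff₀ hd', one_mul, mul_comm]
        exact h
      linarith
  refine (key N).trans ?_
  have : 0 ≤ (((N + K : ℕ) : ℝ)⁻¹) ^ d := by positivity
  nlinarith [one_div_pos.mpr hd']

/-- **Truncation of an even `ℤ`-sum with vanishing central term**: if `g` is summable, even,
`g 0 = 0`, and the shifted tails are dominated, `∑_{m<N} |g(m+K+1)| ≤ B` for all `N`, then
`|∑'_k g k − 2 ∑_{m<K} g(m+1)| ≤ 2B`. [folklore] -/
theorem tsum_int_even_trunc {g : ℤ → ℝ} (hg : Summable g) (heven : ∀ k : ℤ, g (-k) = g k) (h0 : g 0 = 0)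
    (K : ℕ) {B : ℝ} (htail : ∀ N : ℕ, ∑ m ∈ range N, |g ((m + K + 1 : ℕ) : ℤ)| ≤ B) :
    |∑' k, g k - 2 * ∑ m ∈ range K, g ((m + 1 : ℕ) : ℤ)| ≤ 2 * B := by
  have hinj : Function.Injective fun m : ℕ => ((m : ℤ) + 1) := fun a b h => by
    simpa using h
  have h₁ : Summable fun m : ℕ => g ((m : ℤ) + 1) := hg.comp_injective hinj
  have hinj' : Function.Injective fun m : ℕ => (-((m : ℤ) + 1)) := fun a b h => by
    simpa using h
  have h₂ : Summable fun m : ℕ => g (-((m : ℤ) + 1)) := hg.comp_injective hinj'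
  have hsplit := tsum_of_add_one_of_neg_add_one h₁ h₂
  have hneg : ∑' m : ℕ, g (-((m : ℤ) + 1)) = ∑' m : ℕ, g ((m : ℤ) + 1) :=
    tsum_congr fun m => heven _
  -- the positive half: finite part + shifted tail
  have hshift := (h₁.sum_add_tsum_nat_add K).symm
  -- |tail| ≤ B
  have h₁K : Summable fun m : ℕ => g (((m + K : ℕ) : ℤ) + 1) := by
    have := (summable_nat_add_iff K).mpr h₁
    exact this
  have habsK : Summable fun m : ℕ => |g (((m + K : ℕ) : ℤ) + 1)| := h₁K.abs
  have htailB : |∑' m : ℕ, g (((m + K : ℕ) : ℤ) + 1)| ≤ B := by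
    have h1 : |∑' m : ℕ, g (((m + K : ℕ) : ℤ) + 1)| ≤ ∑' m : ℕ, |g (((m + K : ℕ) : ℤ) + 1)| := by
      have := norm_tsum_le_tsum_norm (f := fun m : ℕ => g (((m + K : ℕ) : ℤ) + 1))
        (by simpa [Real.norm_eq_abs] using habsK)
      simpa [Real.norm_eq_abs] using this
    have h2 : ∑' m : ℕ, |g (((m + K : ℕ) : ℤ) + 1)| ≤ B := by
      refine Real.tsum_le_of_sum_range_le (fun m => abs_nonneg _) fun N => ?_
      have := htail N
      refine le_trans (le_of_eq (sum_congr rfl fun m _ => ?_)) this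
      congr 2
    linarith
  have hfin : ∑ m ∈ range K, g ((m : ℤ) + 1) = ∑ m ∈ range K, g ((m + 1 : ℕ) : ℤ) :=
    sum_congr rfl fun m _ => by push_cast; ring_nf
  rw [hsplit, h0, add_zero, hneg, hshift, hfin]
  have e : ∑ m ∈ range K, g ((m + 1 : ℕ) : ℤ) + ∑' m : ℕ, g (((m + K : ℕ) : ℤ) + 1) +
      (∑ m ∈ range K, g ((m + 1 : ℕ) : ℤ) + ∑' m : ℕ, g (((m + K : ℕ) : ℤ) + 1)) -
      2 * ∑ m ∈ range K, g ((m + 1 : ℕ) : ℤ) = 2 * ∑' m : ℕ, g (((m + K : ℕ) : ℤ) + 1) := by ring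
  rw [e, abs_mul, abs_of_pos (by norm_num : (0 : ℝ) < 2)]
  linarith

/-- **Truncation of an even nonnegative `ℤ`-sum**: with `g ≥ 0` summable and even, and
`∑_{m<N} g(m+K+1) ≤ B` for all `N`:
`g 0 + 2∑_{m<K} g(m+1) ≤ ∑'_k g k ≤ g 0 + 2∑_{m<K} g(m+1) + 2B`. [folklore] -/
theorem tsum_int_even_trunc_nonneg {g : ℤ → ℝ} (hg : Summable g) (heven : ∀ k : ℤ, g (-k) = g k)
    (hnn : ∀ k, 0 ≤ g k) (K : ℕ) {B : ℝ} (htail : ∀ N : ℕ, ∑ m ∈ range N, g ((m + K + 1 : ℕ) : ℤ) ≤ B) :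
    g 0 + 2 * ∑ m ∈ range K, g ((m + 1 : ℕ) : ℤ) ≤ ∑' k, g k ∧
    ∑' k, g k ≤ g 0 + 2 * ∑ m ∈ range K, g ((m + 1 : ℕ) : ℤ) + 2 * B := by
  have hinj : Function.Injective fun m : ℕ => ((m : ℤ) + 1) := fun a b h => by
    simpa using h
  have h₁ : Summable fun m : ℕ => g ((m : ℤ) + 1) := hg.comp_injective hinj
  have hinj' : Function.Injective fun m : ℕ => (-((m : ℤ) + 1)) := fun a b h => by
    simpa using h
  have h₂ : Summable fun m : ℕ => g (-((m : ℤ) + 1)) := hg.comp_injective hinj'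
  have hsplit := tsum_of_add_one_of_neg_add_one h₁ h₂
  have hneg : ∑' m : ℕ, g (-((m : ℤ) + 1)) = ∑' m : ℕ, g ((m : ℤ) + 1) :=
    tsum_congr fun m => heven _
  have hshift := (h₁.sum_add_tsum_nat_add K).symm
  have h₁K : Summable fun m : ℕ => g (((m + K : ℕ) : ℤ) + 1) := (summable_nat_add_iff K).mpr h₁
  have htail0 : 0 ≤ ∑' m : ℕ, g (((m + K : ℕ) : ℤ) + 1) := tsum_nonneg fun m => hnn _
  have htailB : ∑' m : ℕ, g (((m + K : ℕ) : ℤ) + 1) ≤ B := by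
    refine Real.tsum_le_of_sum_range_le (fun m => hnn _) fun N => ?_
    have := htail N
    refine le_trans (le_of_eq (sum_congr rfl fun m _ => ?_)) this
    congr 1
  have hfin : ∑ m ∈ range K, g ((m : ℤ) + 1) = ∑ m ∈ range K, g ((m + 1 : ℕ) : ℤ) :=
    sum_congr rfl fun m _ => by push_cast; ring_nf
  rw [hsplit, hneg, hshift, hfin]
  constructor <;> linarith

/-- Membership of the shifted index: `(m + K + 1 : ℕ)` as an integer is nonzero, and its square
is at least `(K+1)²`. [folklore] -/
theorem natCast_shift_facts (m K : ℕ) :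
    ((m + K + 1 : ℕ) : ℤ) ≠ 0 ∧ ((K : ℝ) + 1) ^ 2 ≤ (((m + K + 1 : ℕ) : ℤ) : ℝ) ^ 2 := by
  refine ⟨by omega, ?_⟩
  have hm : (0 : ℝ) ≤ m := Nat.cast_nonneg m
  have hK : (0 : ℝ) ≤ K := Nat.cast_nonneg K
  push_cast
  nlinarith

end Literature.MathematicalPhysics.StatisticalMechanics.StackingSums

end
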